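/-
Copyright (c) 2026 the pub-hodgecm-mathlib formalisation cell (harness21).  Prover seat hodgecm-mathlib-K2E3-p14 (g7), Track B «K2-LIT» ∕ h413
(`stmt-HodgeConjecture-24833`), line `K2_E3_EllipticInputs`, leaf (nsc-S-A′) «principal-block standard span», brick E2-J twin (P₁₂ side), part 2:
JACQUET MODULES IN STAGES FOR `B ≤ P₁₂ ≤ GL₃(F)` — THE SURJECTION `r_{P₂₁} V ↠ r_B V`, ITS KERNEL, ITS `δ`-BOOKKEEPING, AND THE `GL₂`-JACQUET MODULES OF SUBQUOTIENTS.
2026-09-04.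
-/
import Literature.NumberTheory.Automorphic.JacquetGLFunctor                       -- ★ `jacquetGLMap`, `jacquetGLMap_injective` (left exactness of `r_c`)
import Literature.NumberTheory.Automorphic.ParabolicInductionModulusProofs       -- ★ `jacquetGL_leviProjection_mk`, `rootDeltaChar_eq_rootDeltaChar_leviEmbeddingP`
import Summits.HodgeConjecture.HodgeConjecture.Theorems.K2E3GL3InductionInStagesLevi   -- ★ E2-I block bookkeeping (`mulSingle_false_mul_mulSingle_true`)
import Summits.HodgeConjecture.HodgeConjecture.Theorems.K2E3GL3OneTwoLeviBookkeeping  -- ★ twin bookkeeping, `rootDeltaChar_borel_three_eq_mul'`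
import Summits.HodgeConjecture.HodgeConjecture.Theorems.K2E3GL3JacquetInStagesBorel   -- ★ the P₂₁ original (`det_eq_one_of_mem_unipotentRadicalGL_two`)
import HarnessLib

/-!
# K2_E3 road (h413), leaf (nsc-S-A′), brick E2-J twin — Jacquet modules in stages `r_B = r_{B_M′} ∘ r_{P₁₂}` on `GL₃(F)` (the `![false,true,true]` side)

Cell `pub/hodgecm-mathlib` (D-0151), Track B, seat K2E3-p14 (g7); leaf architecture K2E3-p25 (g0) `MEMO-SA-architecture.v1` brick E2, head (E2-J)
H0 HEADS FREEZE (K2 bus 2026-09-04 11:28:14Z: the (1,2)-rules need the P₁₂ twin of ★ `K2E3GL3JacquetInStagesBorel`); this file is that twin, token-for-token.  `--supports stmt-HodgeConjecture-24833 --as helper`; THEOREMS ONLY (no definition ∕ instance ∕ notation ∕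
named fact ∕ `sorry`); never imports `Cruxes/…/Lines`.  COUNT-NEUTRAL.

THE MATHEMATICS ([BernsteinZelevinsky1977, Prop. 1.9 (a)(c) «`r_{M,G} = r_{M,L} ∘ r_{L,G}`», §2.3]; [Casselman1995, Prop. 3.2.3, §3.3]; [Zelevinsky1980, §1.2]).  `Q′ = P₁₂ ≤ GL₃(F)`
(labelling `C′ = ![false,true,true]`), `M′ = GL₁ × GL₂`, `ι′(g₂) = diag(1,g₂)`, `B ≤ Q′` the Borel, `U_B = U_{Q′} ⋊ ι′(U₂)`.  For a representation `V` of `GL₃(F)`: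
* §1 `U_Q ≤ U_B` gives a linear surjection **`p : r_Q V ↠ r_B V`**, `[x]_Q ↦ [x]_B`, whose KERNEL is exactly the `U₂`-coinvariant kernel of the `GL₂`-restriction
  `(r_Q V) ∘ ι` (normalised action; `δ_Q^{1∕2}(ι u) = 1` for unipotent `u`): `V(U_B) = V(U_Q) + V(ι U₂)` via the Levi factorisation `u = diag(proj u)·u′`, `u′ ∈ U_Q`
  (★ `leviEmbeddingP_inv_mul_mem_unipotentRadicalP`) — i.e. `r_B V = r_{B₂}((r_Q V) ∘ ι)` as vector spaces;
* §2 `δ`-BOOKKEEPING: for `m` in the Borel Levi `T = LB 3` with image `μ(m) ∈ M`, `p (r_Q V (μ m) w) = δ_{B₂}^{1∕2}(m|_{GL₂}) · r_B V (m) (p w)` (normalised actions; ★ E2-δ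
  `δ_B^{1∕2} = δ_Q^{1∕2} · δ_{B₂}^{1∕2}`);

HONEST LABEL: HC_CM is proved only modulo the 7 printed citations (2 remaining named inputs: hLiu418 = stmt-HodgeConjecture-24832, h413 =
stmt-HodgeConjecture-24833) until rung 0 closes; count-neutral helper.

## References
* [BernsteinZelevinsky1977] I. N. Bernstein, A. V. Zelevinsky, Ann. Sci. ÉNS 10 (1977): Prop. 1.9, §2.1, §2.3.
* [Casselman1995] W. Casselman, *Introduction to the theory of admissible representations of p-adic reductive groups* (1995): Prop. 3.2.3, §3.3.
* [Zelevinsky1980] A. V. Zelevinsky, Ann. Sci. ÉNS 13 (1980): §1.2.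
-/

set_option autoImplicit false
set_option linter.dupNamespace false

noncomputable section
open scoped MatrixGroups NNReal
namespace Summit.HodgeConjecture.HodgeConjecture.Cruxes.H413.K2E3GL3JacquetInStagesBorelPrime

open Literature.NumberTheory.Automorphic Representation
open K2E3GL3InductionInStagesLevi K2E3GL3OneTwoLeviBookkeeping

/-! ## §1 The surjection `p : r_Q V ↠ r_B V` and its kernel -/

section Kernel

variable {F : Type*} [Field F] {X : Type*} [AddCommGroup X] [Module ℂ X] (V : Representation ℂ (GL (Fin 3) F) X)

/-- `U_{P₁₂} ≤ U_B` acts trivially on `r_B V`: the quotient map `V → r_B V` is `U_{P₁₂}`-invariant (★ `unipotentRadicalGL_comp_le`). [cite: BernsteinZelevinsky1977, §2.1] -/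
theorem mk_comp_restrictUnipotentGL_oneTwo_eq :
    ∀ u : ↥(unipotentRadicalP F (![false, true, true] : Fin 3 → Bool)), Representation.Coinvariants.mk (restrictUnipotentGL F (id : Fin 3 → Fin 3) V) ∘ₗ (restrictUnipotentGL F (![false, true, true] : Fin 3 → Bool) V) u =
      Representation.Coinvariants.mk (restrictUnipotentGL F (id : Fin 3 → Fin 3) V) := by
  intro u
  have hu : ((u : ↥(standardParabolicGL F (![false, true, true] : Fin 3 → Bool))) : GL (Fin 3) F) ∈ unipotentRadicalGL F (id : Fin 3 → Fin 3) :=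
    unipotentRadicalGL_comp_le (R := F) (id : Fin 3 → Fin 3) (f := (![false, true, true] : Fin 3 → Bool)) monotone_oneTwo ⟨(u : ↥(standardParabolicGL F (![false, true, true] : Fin 3 → Bool))), u.2, rfl⟩
  obtain ⟨u', hu', hu'eq⟩ := hu
  refine LinearMap.ext fun x => ?_
  rw [LinearMap.comp_apply]
  have : (restrictUnipotentGL F (![false, true, true] : Fin 3 → Bool) V) u x = (restrictUnipotentGL F (id : Fin 3 → Fin 3) V) ⟨u', hu'⟩ x := by
    show V ((u : ↥(standardParabolicGL F (![false, true, true] : Fin 3 → Bool))) : GL (Fin 3) F) x = V ((u' : GL (Fin 3) F)) x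
    rw [← hu'eq]; rfl
  rw [this]
  exact Coinvariants.mk_self_apply _ _ _

/-- `p [x]_Q = [x]_B`. [cite: BernsteinZelevinsky1977, Prop. 1.9 (c)] -/
theorem stagesMap_mk (x : X) :
    (Representation.Coinvariants.lift (restrictUnipotentGL F (![false, true, true] : Fin 3 → Bool) V) (Representation.Coinvariants.mk (restrictUnipotentGL F (id : Fin 3 → Fin 3) V)) (K2E3GL3JacquetInStagesBorelPrime.mk_comp_restrictUnipotentGL_oneTwo_eq V)) (Representation.Coinvariants.mk (restrictUnipotentGL F (![false, true, true] : Fin 3 → Bool) V) x) = Representation.Coinvariants.mk (restrictUnipotentGL F (id : Fin 3 → Fin 3) V) x :=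
  rfl

/-- `p : r_Q V → r_B V` is surjective. [cite: BernsteinZelevinsky1977, Prop. 1.9 (c)] -/
theorem stagesMap_surjective : Function.Surjective (Representation.Coinvariants.lift (restrictUnipotentGL F (![false, true, true] : Fin 3 → Bool) V) (Representation.Coinvariants.mk (restrictUnipotentGL F (id : Fin 3 → Fin 3) V)) (K2E3GL3JacquetInStagesBorelPrime.mk_comp_restrictUnipotentGL_oneTwo_eq V)) := by
  intro a
  obtain ⟨x, rfl⟩ := Coinvariants.mk_surjective _ a
  exact ⟨Coinvariants.mk _ x, rfl⟩

end Kernel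

section KernelTwo

variable {F : Type*} [Field F] [ValuativeRel F] [TopologicalSpace F] [IsNonarchimedeanLocalField F]
  (e : Fin 2 ≃ {i : Fin 3 // (![false, true, true] : Fin 3 → Bool) i = true})
  (he : ∀ j : Fin 2, ((e j : {i : Fin 3 // (![false, true, true] : Fin 3 → Bool) i = true}) : Fin 3) = Fin.succ j)
  {X : Type*} [AddCommGroup X] [Module ℂ X] (V : Representation ℂ (GL (Fin 3) F) X)

omit [ValuativeRel F] [TopologicalSpace F] [IsNonarchimedeanLocalField F] in
include he in
/-- `ι′(U₂) ≤ U_B`: for an upper unitriangular `k ∈ GL₂`, `diag(1, k)` is upper unitriangular in `GL₃`. [cite: BernsteinZelevinsky1977, §2.1] -/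
theorem blockDiagonalGL_mulSingle_true_mem_unipotentRadicalGL (k : GL (Fin 2) F) (hk : k ∈ unipotentRadicalGL F (id : Fin 2 → Fin 2)) :
    blockDiagonalGL F (![false, true, true] : Fin 3 → Bool) (Pi.mulSingle (M := (fun a : Bool => GL {i : Fin 3 // (![false, true, true] : Fin 3 → Bool) i = a} F)) true (reindexGL e k)) ∈ unipotentRadicalGL F (id : Fin 3 → Fin 3) := by
  rw [mem_unipotentRadicalGL_iff_entry] at hk ⊢
  obtain ⟨hbt, hdiag⟩ := hk
  rw [← coe_leviEmbeddingP]
  refine ⟨fun i j hij => ?_, fun i j hij => ?_⟩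
  · induction i using Fin.cases with
    | zero => exact absurd (Fin.zero_le _) (not_le.2 hij)
    | succ i =>
      induction j using Fin.cases with
      | zero => rw [blockEmbedding_apply_succ_zero]
      | succ j => rw [blockEmbedding_apply_succ e he]; exact hbt (Fin.succ_lt_succ_iff.1 hij)
  · obtain rfl : i = j := hij
    induction i using Fin.cases with
    | zero => rw [blockEmbedding_apply_zero_zero, Matrix.one_apply_eq]
    | succ i => rw [blockEmbedding_apply_succ e he, hdiag i i rfl, Matrix.one_apply_eq, Matrix.one_apply_eq]

/-- `δ_{P₁₂}^{1∕2}(ι′ k) = 1` for `k` upper unitriangular (`‖det k‖ = 1`, ★ `rootDeltaChar_standardParabolicGL_bool`). [cite: BernsteinZelevinsky1977, 1.7 and §2.3] -/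
theorem rootDeltaChar_blockEmbedding_eq_one_of_mem_unipotentRadicalGL (k : GL (Fin 2) F) (hk : k ∈ unipotentRadicalGL F (id : Fin 2 → Fin 2)) :
    rootDeltaChar (standardParabolicGL F (![false, true, true] : Fin 3 → Bool)) (leviEmbeddingP F (![false, true, true] : Fin 3 → Bool) (Pi.mulSingle (M := (fun a : Bool => GL {i : Fin 3 // (![false, true, true] : Fin 3 → Bool) i = a} F)) true (reindexGL e k))) = 1 := by
  haveI : IsTopologicalRing F := inferInstance
  apply Units.ext
  rw [rootDeltaChar_standardParabolicGL_bool, leviProjection_leviEmbeddingP_apply, Pi.mulSingle_eq_same,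
    Pi.mulSingle_eq_of_ne (show false ≠ true by decide), map_one, Units.val_one, map_one, one_pow, one_mul,
    Matrix.GeneralLinearGroup.val_det_apply, coe_reindexGL, Matrix.det_reindex_self, ← Matrix.GeneralLinearGroup.val_det_apply,
    K2E3GL3JacquetInStagesBorel.det_eq_one_of_mem_unipotentRadicalGL_two k hk, Units.val_one, map_one, one_pow, inv_one, NNReal.sqrt_one, NNReal.coe_one, Complex.ofReal_one, Units.val_one]

/-- The NORMALISED action of `ι′ k`, `k` upper unitriangular, on `r_{Q′} V`: `r_{Q′} V (ι′ k) [x] = [V(diag(1,k)) x]` (no `δ`). [cite: BernsteinZelevinsky1977, §1.8] -/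
theorem normalizedJacquetGL_blockEmbedding_mk_of_mem_unipotentRadicalGL (k : GL (Fin 2) F) (hk : k ∈ unipotentRadicalGL F (id : Fin 2 → Fin 2)) (x : X) :
    (normalizedJacquetGL F (![false, true, true] : Fin 3 → Bool) V) (Pi.mulSingle (M := (fun a : Bool => GL {i : Fin 3 // (![false, true, true] : Fin 3 → Bool) i = a} F)) true (reindexGL e k)) (Representation.Coinvariants.mk (restrictUnipotentGL F (![false, true, true] : Fin 3 → Bool) V) x) =
      Representation.Coinvariants.mk (restrictUnipotentGL F (![false, true, true] : Fin 3 → Bool) V) (V (blockDiagonalGL F (![false, true, true] : Fin 3 → Bool) (Pi.mulSingle (M := (fun a : Bool => GL {i : Fin 3 // (![false, true, true] : Fin 3 → Bool) i = a} F)) true (reindexGL e k))) x) := by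
  rw [normalizedJacquetGL_mk, rootDeltaChar_blockEmbedding_eq_one_of_mem_unipotentRadicalGL e k hk, inv_one, Units.val_one, one_smul]

omit [ValuativeRel F] [TopologicalSpace F] [IsNonarchimedeanLocalField F] in
include he in
/-- The `GL₂`-block of `u ∈ U_B` is upper unitriangular. [cite: BernsteinZelevinsky1977, §2.1] -/
theorem reindexGL_symm_leviProjection_mem_unipotentRadicalGL (u : ↥(unipotentRadicalP F (id : Fin 3 → Fin 3))) :
    (reindexGL e).symm (leviProjection F (![false, true, true] : Fin 3 → Bool) ⟨((u : ↥(standardParabolicGL F (id : Fin 3 → Fin 3))) : GL (Fin 3) F),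
        borel_le_standardParabolicGL monotone_oneTwo (u : ↥(standardParabolicGL F (id : Fin 3 → Fin 3))).2⟩ true) ∈
      unipotentRadicalGL F (id : Fin 2 → Fin 2) := by
  have hu : ((u : ↥(standardParabolicGL F (id : Fin 3 → Fin 3))) : GL (Fin 3) F) ∈ unipotentRadicalGL F (id : Fin 3 → Fin 3) :=
    ⟨(u : ↥(standardParabolicGL F (id : Fin 3 → Fin 3))), u.2, rfl⟩
  rw [mem_unipotentRadicalGL_iff_entry] at hu ⊢
  obtain ⟨hbt, hdiag⟩ := hu
  refine ⟨fun i j hij => ?_, fun i j hij => ?_⟩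
  · rw [reindex_block_apply' e he]; exact hbt (Fin.succ_lt_succ_iff.2 hij)
  · obtain rfl : i = j := hij
    rw [reindex_block_apply' e he, hdiag _ _ rfl, Matrix.one_apply_eq, Matrix.one_apply_eq]

omit [ValuativeRel F] [TopologicalSpace F] [IsNonarchimedeanLocalField F] in
/-- The `GL₁`-block of `u ∈ U_B` is `1`. [cite: BernsteinZelevinsky1977, §2.1] -/
theorem leviProjection_false_eq_one (u : ↥(unipotentRadicalP F (id : Fin 3 → Fin 3))) :
    leviProjection F (![false, true, true] : Fin 3 → Bool) ⟨((u : ↥(standardParabolicGL F (id : Fin 3 → Fin 3))) : GL (Fin 3) F),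
        borel_le_standardParabolicGL monotone_oneTwo (u : ↥(standardParabolicGL F (id : Fin 3 → Fin 3))).2⟩ false = 1 := by
  have hu : ((u : ↥(standardParabolicGL F (id : Fin 3 → Fin 3))) : GL (Fin 3) F) ∈ unipotentRadicalGL F (id : Fin 3 → Fin 3) :=
    ⟨(u : ↥(standardParabolicGL F (id : Fin 3 → Fin 3))), u.2, rfl⟩
  rw [mem_unipotentRadicalGL_iff_entry] at hu
  haveI := subsingleton_block_false
  ext i j
  obtain rfl : i = j := Subsingleton.elim i j
  have hi : i = ⟨0, rfl⟩ := Subsingleton.elim _ _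
  subst hi
  rw [leviProjection_apply_coe, Units.val_one, Matrix.one_apply_eq]
  exact (hu.2 0 0 rfl).trans (Matrix.one_apply_eq 0)

set_option maxHeartbeats 400000 in
include he in
/-- **THE KERNEL OF `p′ : r_{Q′} V ↠ r_B V` IS THE `U₂`-COINVARIANT KERNEL OF THE `GL₂`-RESTRICTION `(r_{Q′} V) ∘ ι′`** (normalised action), i.e. `r_B V = r_{B₂}((r_{Q′} V)∘ι′)`
as vector spaces (twin of ★ `K2E3GL3JacquetInStagesBorel.ker_stagesMap_eq`: `u = diag(proj u)·u′`, `u′ ∈ U_{Q′}`, Levi part `ι′(k)`, `k ∈ U₂`). [cite: BernsteinZelevinsky1977, Prop. 1.9 (c)] [cite: Casselman1995, Prop. 3.2.3] -/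
theorem ker_stagesMap_eq : LinearMap.ker (Representation.Coinvariants.lift (restrictUnipotentGL F (![false, true, true] : Fin 3 → Bool) V) (Representation.Coinvariants.mk (restrictUnipotentGL F (id : Fin 3 → Fin 3) V)) (K2E3GL3JacquetInStagesBorelPrime.mk_comp_restrictUnipotentGL_oneTwo_eq V)) = (Representation.Coinvariants.ker (restrictUnipotentGL F (id : Fin 2 → Fin 2) ((normalizedJacquetGL F (![false, true, true] : Fin 3 → Bool) V).comp ((MonoidHom.mulSingle (fun a : Bool => GL {i : Fin 3 // (![false, true, true] : Fin 3 → Bool) i = a} F) true).comp (reindexGL e).toMonoidHom) : Representation ℂ (GL (Fin 2) F) (restrictUnipotentGL F (![false, true, true] : Fin 3 → Bool) V).Coinvariants))) := by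
  apply le_antisymm
  · intro w hw
    obtain ⟨x, rfl⟩ := Coinvariants.mk_surjective _ w
    rw [LinearMap.mem_ker, stagesMap_mk, Coinvariants.mk_eq_zero] at hw
    refine Submodule.span_induction (p := fun y _ => Representation.Coinvariants.mk (restrictUnipotentGL F (![false, true, true] : Fin 3 → Bool) V) y ∈ (Representation.Coinvariants.ker (restrictUnipotentGL F (id : Fin 2 → Fin 2) ((normalizedJacquetGL F (![false, true, true] : Fin 3 → Bool) V).comp ((MonoidHom.mulSingle (fun a : Bool => GL {i : Fin 3 // (![false, true, true] : Fin 3 → Bool) i = a} F) true).comp (reindexGL e).toMonoidHom) : Representation ℂ (GL (Fin 2) F) (restrictUnipotentGL F (![false, true, true] : Fin 3 → Bool) V).Coinvariants)))) ?_ ?_ ?_ ?_ hw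
    · rintro _ ⟨⟨u, y⟩, rfl⟩
      dsimp only
      -- Levi factorisation of `u ∈ U_B ≤ P₂₁`
      set q : ↥(standardParabolicGL F (![false, true, true] : Fin 3 → Bool)) := ⟨((u : ↥(standardParabolicGL F (id : Fin 3 → Fin 3))) : GL (Fin 3) F),
        borel_le_standardParabolicGL monotone_oneTwo (u : ↥(standardParabolicGL F (id : Fin 3 → Fin 3))).2⟩ with hq
      set n : (Π a : Bool, GL {i : Fin 3 // (![false, true, true] : Fin 3 → Bool) i = a} F) := leviProjection F (![false, true, true] : Fin 3 → Bool) q with hn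
      set k : GL (Fin 2) F := (reindexGL e).symm (n true) with hkdef
      have hk : k ∈ unipotentRadicalGL F (id : Fin 2 → Fin 2) := reindexGL_symm_leviProjection_mem_unipotentRadicalGL e he u
      obtain ⟨k', hk', hk'eq⟩ := hk
      have hnk : n = Pi.mulSingle (M := (fun a : Bool => GL {i : Fin 3 // (![false, true, true] : Fin 3 → Bool) i = a} F)) true (reindexGL e k) := by
        rw [← mulSingle_false_mul_mulSingle_true n, hn, leviProjection_false_eq_one u, Pi.mulSingle_one, one_mul, hkdef, MulEquiv.apply_symm_apply]
      have hu' : (leviEmbeddingP F (![false, true, true] : Fin 3 → Bool) n)⁻¹ * q ∈ unipotentRadicalP F (![false, true, true] : Fin 3 → Bool) := leviEmbeddingP_inv_mul_mem_unipotentRadicalP q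
      have hVu : (restrictUnipotentGL F (id : Fin 3 → Fin 3) V) u y = V (blockDiagonalGL F (![false, true, true] : Fin 3 → Bool) n) (V (((leviEmbeddingP F (![false, true, true] : Fin 3 → Bool) n)⁻¹ * q : ↥(standardParabolicGL F (![false, true, true] : Fin 3 → Bool))) : GL (Fin 3) F) y) := by
        rw [← Module.End.mul_apply, ← map_mul, ← coe_leviEmbeddingP, ← Subgroup.coe_mul, mul_inv_cancel_left]; rfl
      have hsplit : (restrictUnipotentGL F (id : Fin 3 → Fin 3) V) u y - y =
          V (blockDiagonalGL F (![false, true, true] : Fin 3 → Bool) n) ((restrictUnipotentGL F (![false, true, true] : Fin 3 → Bool) V) ⟨_, hu'⟩ y - y) + (V (blockDiagonalGL F (![false, true, true] : Fin 3 → Bool) n) y - y) := by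
        rw [hVu, map_sub]; exact (sub_add_sub_cancel _ _ _).symm
      rw [hsplit, map_add, ← jacquetGL_mk, map_sub (Representation.Coinvariants.mk (restrictUnipotentGL F (![false, true, true] : Fin 3 → Bool) V)) ((restrictUnipotentGL F (![false, true, true] : Fin 3 → Bool) V) _ y) y,
        Coinvariants.mk_self_apply, sub_self, map_zero, zero_add, map_sub, ← jacquetGL_mk]
      -- `r_Q(n)[y] - [y]` with `n = ι k`, `k ∈ U₂`
      have hJ : jacquetGL F (![false, true, true] : Fin 3 → Bool) V n (Representation.Coinvariants.mk (restrictUnipotentGL F (![false, true, true] : Fin 3 → Bool) V) y) =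
          (normalizedJacquetGL F (![false, true, true] : Fin 3 → Bool) V) n (Representation.Coinvariants.mk (restrictUnipotentGL F (![false, true, true] : Fin 3 → Bool) V) y) := by
        rw [jacquetGL_mk, hnk, normalizedJacquetGL_blockEmbedding_mk_of_mem_unipotentRadicalGL e V k ⟨k', hk', hk'eq⟩]
      rw [hJ, hnk, ← hk'eq]
      exact Coinvariants.sub_mem_ker (ρ := restrictUnipotentGL F (id : Fin 2 → Fin 2) ((normalizedJacquetGL F (![false, true, true] : Fin 3 → Bool) V).comp ((MonoidHom.mulSingle (fun a : Bool => GL {i : Fin 3 // (![false, true, true] : Fin 3 → Bool) i = a} F) true).comp (reindexGL e).toMonoidHom) : Representation ℂ (GL (Fin 2) F) (restrictUnipotentGL F (![false, true, true] : Fin 3 → Bool) V).Coinvariants)) ⟨k', hk'⟩ _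
    · rw [map_zero]; exact Submodule.zero_mem _
    · intro a b _ _ ha hb; rw [map_add]; exact Submodule.add_mem _ ha hb
    · intro a y _ hy; rw [map_smul]; exact Submodule.smul_mem _ a hy
  · refine Submodule.span_le.2 ?_
    rintro _ ⟨⟨u, w⟩, rfl⟩
    rw [SetLike.mem_coe, LinearMap.mem_ker, map_sub, sub_eq_zero]
    obtain ⟨x, rfl⟩ := Coinvariants.mk_surjective _ w
    have hu : ((u : ↥(standardParabolicGL F (id : Fin 2 → Fin 2))) : GL (Fin 2) F) ∈ unipotentRadicalGL F (id : Fin 2 → Fin 2) :=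
      ⟨(u : ↥(standardParabolicGL F (id : Fin 2 → Fin 2))), u.2, rfl⟩
    show (Representation.Coinvariants.lift (restrictUnipotentGL F (![false, true, true] : Fin 3 → Bool) V) (Representation.Coinvariants.mk (restrictUnipotentGL F (id : Fin 3 → Fin 3) V)) (K2E3GL3JacquetInStagesBorelPrime.mk_comp_restrictUnipotentGL_oneTwo_eq V)) ((normalizedJacquetGL F (![false, true, true] : Fin 3 → Bool) V) (Pi.mulSingle (M := (fun a : Bool => GL {i : Fin 3 // (![false, true, true] : Fin 3 → Bool) i = a} F)) true (reindexGL e ((u : ↥(standardParabolicGL F (id : Fin 2 → Fin 2))) : GL (Fin 2) F)))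
      (Representation.Coinvariants.mk (restrictUnipotentGL F (![false, true, true] : Fin 3 → Bool) V) x)) = _
    obtain ⟨u₃, hu₃, hu₃eq⟩ := blockDiagonalGL_mulSingle_true_mem_unipotentRadicalGL e he _ hu
    rw [normalizedJacquetGL_blockEmbedding_mk_of_mem_unipotentRadicalGL e V _ hu, stagesMap_mk, stagesMap_mk, ← hu₃eq]
    exact Coinvariants.mk_self_apply (restrictUnipotentGL F (id : Fin 3 → Fin 3) V) ⟨u₃, hu₃⟩ x

end KernelTwo

/-! ## §2 `δ`-bookkeeping: `p′` intertwines `r_{Q′} V ∘ μ″`, up to `δ_{B₂}^{1∕2}`, with `r_B V` -/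

section Delta

variable {F : Type*} [Field F] [ValuativeRel F] [TopologicalSpace F] [IsNonarchimedeanLocalField F]
  (e : Fin 2 ≃ {i : Fin 3 // (![false, true, true] : Fin 3 → Bool) i = true})
  (he : ∀ j : Fin 2, ((e j : {i : Fin 3 // (![false, true, true] : Fin 3 → Bool) i = true}) : Fin 3) = Fin.succ j)
  {X : Type*} [AddCommGroup X] [Module ℂ X] (V : Representation ℂ (GL (Fin 3) F) X)

include he in
/-- **`δ`-BOOKKEEPING FOR JACQUET MODULES IN STAGES (P₁₂ side).**  For `m` in the diagonal torus with image `μ″(m) = proj_{P₁₂}(diag m)` in `M′ = GL₁ × GL₂`: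
`p′ (r_{Q′} V (μ″ m) w) = δ_{B₂}^{1∕2}(m|_{\{1,2\}}) · r_B V (m) (p′ w)` (★ twin `rootDeltaChar_borel_three_eq_mul'`). [cite: BernsteinZelevinsky1977, Prop. 1.9 (c)]
[cite: Casselman1995, §3.3] -/
theorem stagesMap_normalizedJacquetGL_levi (m : (Π a : Fin 3, GL {i : Fin 3 // (id : Fin 3 → Fin 3) i = a} F)) (w : (restrictUnipotentGL F (![false, true, true] : Fin 3 → Bool) V).Coinvariants) :
    (Representation.Coinvariants.lift (restrictUnipotentGL F (![false, true, true] : Fin 3 → Bool) V) (Representation.Coinvariants.mk (restrictUnipotentGL F (id : Fin 3 → Fin 3) V)) (K2E3GL3JacquetInStagesBorelPrime.mk_comp_restrictUnipotentGL_oneTwo_eq V)) ((normalizedJacquetGL F (![false, true, true] : Fin 3 → Bool) V) (((leviProjection F (![false, true, true] : Fin 3 → Bool)).comp ((Subgroup.inclusion (borel_le_standardParabolicGL K2E3GL3OneTwoLeviBookkeeping.monotone_oneTwo)).comp (leviEmbeddingP F (id : Fin 3 → Fin 3)))) m) w) =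
      ((rootDeltaChar (standardParabolicGL F (id : Fin 2 → Fin 2)) ⟨(reindexGL e).symm (leviProjection F (![false, true, true] : Fin 3 → Bool)
          ⟨(leviEmbeddingP F (id : Fin 3 → Fin 3) m : GL (Fin 3) F), borel_le_standardParabolicGL monotone_oneTwo (leviEmbeddingP F (id : Fin 3 → Fin 3) m).2⟩ true),
          reindex_block_mem_borel_two' e he (leviEmbeddingP F (id : Fin 3 → Fin 3) m)⟩ : ℂˣ) : ℂ) • (normalizedJacquetGL F (id : Fin 3 → Fin 3) V) m ((Representation.Coinvariants.lift (restrictUnipotentGL F (![false, true, true] : Fin 3 → Bool) V) (Representation.Coinvariants.mk (restrictUnipotentGL F (id : Fin 3 → Fin 3) V)) (K2E3GL3JacquetInStagesBorelPrime.mk_comp_restrictUnipotentGL_oneTwo_eq V)) w) := by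
  haveI : IsTopologicalRing F := inferInstance
  obtain ⟨x, rfl⟩ := Coinvariants.mk_surjective _ w
  set q : ↥(standardParabolicGL F (![false, true, true] : Fin 3 → Bool)) := ⟨(leviEmbeddingP F (id : Fin 3 → Fin 3) m : GL (Fin 3) F),
    borel_le_standardParabolicGL monotone_oneTwo (leviEmbeddingP F (id : Fin 3 → Fin 3) m).2⟩ with hq
  have hE := rootDeltaChar_borel_three_eq_mul' e he (leviEmbeddingP F (id : Fin 3 → Fin 3) m)
  -- the left-hand side: `r_Q V (proj q) [x] = δ_Q^{1/2}(q)⁻¹ • [V q x]`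
  have hL : (normalizedJacquetGL F (![false, true, true] : Fin 3 → Bool) V) (((leviProjection F (![false, true, true] : Fin 3 → Bool)).comp ((Subgroup.inclusion (borel_le_standardParabolicGL K2E3GL3OneTwoLeviBookkeeping.monotone_oneTwo)).comp (leviEmbeddingP F (id : Fin 3 → Fin 3)))) m) (Representation.Coinvariants.mk (restrictUnipotentGL F (![false, true, true] : Fin 3 → Bool) V) x) =
      (((rootDeltaChar (standardParabolicGL F (![false, true, true] : Fin 3 → Bool)) q)⁻¹ : ℂˣ) : ℂ) • Representation.Coinvariants.mk (restrictUnipotentGL F (![false, true, true] : Fin 3 → Bool) V) (V (q : GL (Fin 3) F) x) := by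
    have h1 : (normalizedJacquetGL F (![false, true, true] : Fin 3 → Bool) V) (((leviProjection F (![false, true, true] : Fin 3 → Bool)).comp ((Subgroup.inclusion (borel_le_standardParabolicGL K2E3GL3OneTwoLeviBookkeeping.monotone_oneTwo)).comp (leviEmbeddingP F (id : Fin 3 → Fin 3)))) m) (Representation.Coinvariants.mk (restrictUnipotentGL F (![false, true, true] : Fin 3 → Bool) V) x) =
        (((((rootDeltaChar (standardParabolicGL F (![false, true, true] : Fin 3 → Bool))).comp (leviEmbeddingP F (![false, true, true] : Fin 3 → Bool)))⁻¹ (leviProjection F (![false, true, true] : Fin 3 → Bool) q) : ℂˣ) : ℂ)) •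
          jacquetGL F (![false, true, true] : Fin 3 → Bool) V (leviProjection F (![false, true, true] : Fin 3 → Bool) q) (Representation.Coinvariants.mk (restrictUnipotentGL F (![false, true, true] : Fin 3 → Bool) V) x) := rfl
    rw [h1, jacquetGL_leviProjection_mk, MonoidHom.inv_apply, MonoidHom.comp_apply, ← rootDeltaChar_eq_rootDeltaChar_leviEmbeddingP]
  rw [hL, map_smul, stagesMap_mk, stagesMap_mk, normalizedJacquetGL_mk, smul_smul]
  congr 1
  rw [Units.val_inv_eq_inv_val, Units.val_inv_eq_inv_val, hE, mul_inv, mul_comm (((rootDeltaChar (standardParabolicGL F (![false, true, true] : Fin 3 → Bool)) q : ℂˣ) : ℂ))⁻¹, ← mul_assoc,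
    mul_inv_cancel₀ (Units.ne_zero _), one_mul]

end Delta


end Summit.HodgeConjecture.HodgeConjecture.Cruxes.H413.K2E3GL3JacquetInStagesBorelPrime

end
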